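import Summits.CriticalPhenomena.PercolationContinuityZ3.Theorems.PercNearOneGluingNoHeavyLowerTailThreePointGammaCombDict
import Mathlib.Data.Nat.Choose.Sum
import HarnessLib

/-!
# `NoHeavyLowerTail` (stmt-CriticalPhenomena-4575) — comb positivity of `Γ`, IV: the INTERVAL SPLITS of `Γ` are nonnegative (weight-free C2)

Support file (prover prim-ineq-gen-2 gen 5; `--supports stmt-CriticalPhenomena-4575`).  Small technical definitions, no named facts, no sorries.
THEOREM (`gammaKernel_interval_nonneg`, = Conjecture C2 of prim-ineq-gen-2 HMAX-SPLIT §17 / ttrl2 census line 489, all supports):  for the symmetric kernel `K2 = 2·K_Γ`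
of the quadratic row `Γ = q t − u_a u_b − u_a u_c − u_b u_c − u_a(n_a + n′_a)` (written with the cell events of `ThreePointGamma`), every support `D`, and all disjoint
`O, M ⊆ D`:   `Σ_{R ⊆ M} K2(O ∪ R, O ∪ (M ∖ R)) ≥ 0`,  i.e. every tensor-Bernstein coefficient of `Γ` is `≥ 0` (GAMMA-COMB-THEOREM.md, Lemma 1 + Theorem 2).
Proof: pull the certificate back through `Φ₃, Φ₄` (part III), sum out copy `0` by inclusion–exclusion (`sum_Asg_ignore_fst`), identify the raw certificate kernel with
half of `K2` (`rawF_add_rawF_swap`, a finite Boolean check under transitivity of connection), and invoke complete monotonicity (part II).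
-/

noncomputable section

namespace Summit.CriticalPhenomena.PercolationContinuityZ3.Theorems

namespace ThreePointGamma

open Finset Literature.Probability.Percolation Literature.Probability.Percolation.DecisionTree
open Literature.Probability.Percolation.Gladkov ThreePointLB
open scoped Classical

variable {V : Type*} [Fintype V] [DecidableEq V]

section Raw

variable (D : Finset (Sym2 V)) (a b c : V)

/-- The raw certificate kernel: `λ₃`-half minus `λ₄`-half evaluated on one and the same pair of configurations. [this work] -/
def rawF (ξ ξ' : Finset (Sym2 V)) : ℝ := gqG D a b c ξ ξ' - gqH a b c ξ ξ'

variable {D a b c} {O M : Finset (Sym2 V)}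

/-- At a diagonal base the complete-monotonicity sum equals the signed state sum of the RAW kernel on copies `1, 2`. [this work] -/
theorem combSum_eq_raw (hO : O ⊆ D) (hM : M ⊆ D) (hOM : Disjoint O M) :
    ∑ κ ∈ Asg M, sgn M κ * (- gcert D a b c (trip O O O κ)) = ∑ κ ∈ Asg M, sgn M κ * rawF D a b c (O ∪ κ.2.1) (O ∪ κ.2.2) := by
  have h1 : ∀ x : Fin 3 → Finset (Sym2 V),
      - gcert D a b c x = gqG D a b c (phi3 a b x 1) (phi3 a b x 2) - gqH a b c (phi4 a b x 1) (phi4 a b x 2) := by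
    intro x; rw [gcert_eq_gq, gq_eq_sub]; ring
  calc ∑ κ ∈ Asg M, sgn M κ * (- gcert D a b c (trip O O O κ))
      = ∑ x ∈ triples D, pwt O M (kvec x) * (- gcert D a b c x) := sum_Asg_eq_sum_triples hO hM hOM (fun x => - gcert D a b c x)
    _ = ∑ x ∈ triples D, pwt O M (kvec x) * gqG D a b c (phi3 a b x 1) (phi3 a b x 2)
          - ∑ x ∈ triples D, pwt O M (kvec x) * gqH a b c (phi4 a b x 1) (phi4 a b x 2) := by
        rw [← sum_sub_distrib]; exact sum_congr rfl fun x _ => by rw [h1]; ring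
    _ = ∑ x ∈ triples D, pwt O M (kvec x) * gqG D a b c (x 1) (x 2) - ∑ x ∈ triples D, pwt O M (kvec x) * gqH a b c (x 1) (x 2) := by
        rw [sum_kvec_comp_phi3, sum_kvec_comp_phi4]
    _ = ∑ x ∈ triples D, pwt O M (kvec x) * rawF D a b c (x 1) (x 2) := by
        rw [← sum_sub_distrib]; exact sum_congr rfl fun x _ => by unfold rawF; ring
    _ = ∑ κ ∈ Asg M, sgn M κ * rawF D a b c (trip O O O κ 1) (trip O O O κ 2) :=
        (sum_Asg_eq_sum_triples hO hM hOM (fun x => rawF D a b c (x 1) (x 2))).symm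
    _ = ∑ κ ∈ Asg M, sgn M κ * rawF D a b c (O ∪ κ.2.1) (O ∪ κ.2.2) :=
        sum_congr rfl fun κ _ => by rw [(trip_diag κ).2.1, (trip_diag κ).2.2]

end Raw

section IE

variable {M : Finset (Sym2 V)}

omit [Fintype V] in
/-- `Σ_{S ⊆ W} (−1)^{#(W ∖ S)} = [W = ∅]`. [folklore] -/
theorem sum_powerset_neg_one_pow_sdiff (W : Finset (Sym2 V)) :
    ∑ S ∈ W.powerset, ((-1 : ℝ)) ^ (W \ S).card = if W = ∅ then 1 else 0 := by
  have h := sum_powerset_neg_one_pow_card (x := W)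
  have h' : ∑ S ∈ W.powerset, ((-1 : ℝ)) ^ S.card = if W = ∅ then 1 else 0 := by
    have := congrArg (fun z : ℤ => (z : ℝ)) h
    simp only [Int.cast_sum, Int.cast_pow, Int.cast_neg, Int.cast_one, Int.cast_ite, Int.cast_zero] at this
    exact this
  rw [← h']
  refine sum_nbij' (fun S => W \ S) (fun S => W \ S) ?_ ?_ ?_ ?_ ?_
  · intro S _; exact mem_powerset.2 sdiff_subset
  · intro S _; exact mem_powerset.2 sdiff_subset
  · intro S hS; exact Finset.sdiff_sdiff_eq_self (mem_powerset.1 hS)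
  · intro S hS; exact Finset.sdiff_sdiff_eq_self (mem_powerset.1 hS)
  · intro S _; rfl

omit [Fintype V] in
/-- **Summing out copy `0`**: a state weight that ignores the copy-`0` component collapses the signed sum to the COMPLEMENTARY pairs. [this work] -/
theorem sum_Asg_ignore_fst (g : Finset (Sym2 V) → Finset (Sym2 V) → ℝ) :
    ∑ κ ∈ Asg M, sgn M κ * g κ.2.1 κ.2.2 = ∑ R ∈ M.powerset, g R (M \ R) := by
  -- rewrite the left side as a sum over pairs `q = (κ₂, κ₃)` of an inner sum over `κ₁`
  have hL : ∑ κ ∈ Asg M, sgn M κ * g κ.2.1 κ.2.2 =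
      ∑ q ∈ M.powerset ×ˢ M.powerset, ∑ κ₁ ∈ M.powerset,
        (if Disjoint κ₁ q.1 ∧ Disjoint κ₁ q.2 ∧ Disjoint q.1 q.2 then sgn M (κ₁, q) * g q.1 q.2 else 0) := by
    unfold Asg
    rw [sum_filter, sum_product, sum_comm]
  rw [hL]
  -- evaluate the inner sum
  have hin : ∀ q ∈ M.powerset ×ˢ M.powerset,
      ∑ κ₁ ∈ M.powerset, (if Disjoint κ₁ q.1 ∧ Disjoint κ₁ q.2 ∧ Disjoint q.1 q.2 then sgn M (κ₁, q) * g q.1 q.2 else 0) =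
        if Disjoint q.1 q.2 ∧ q.1 ∪ q.2 = M then g q.1 q.2 else 0 := by
    intro q hq
    obtain ⟨hq1, hq2⟩ := mem_product.1 hq
    rw [mem_powerset] at hq1 hq2
    by_cases hd : Disjoint q.1 q.2
    · -- inner sum = g · Σ_{κ₁ ⊆ W} (−1)^{#(W∖κ₁)}, W = M ∖ (q.1 ∪ q.2)
      set W := M \ (q.1 ∪ q.2) with hW
      have hre : ∑ κ₁ ∈ M.powerset, (if Disjoint κ₁ q.1 ∧ Disjoint κ₁ q.2 ∧ Disjoint q.1 q.2 then sgn M (κ₁, q) * g q.1 q.2 else 0) =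
          ∑ κ₁ ∈ W.powerset, ((-1 : ℝ)) ^ (W \ κ₁).card * g q.1 q.2 := by
        rw [← sum_filter]
        refine sum_congr ?_ fun κ₁ hκ₁ => ?_
        · ext κ₁
          simp only [mem_filter, mem_powerset, hW, subset_sdiff, disjoint_union_right]
          tauto
        · have hset : M \ ((κ₁, q).1 ∪ (κ₁, q).2.1 ∪ (κ₁, q).2.2) = W \ κ₁ := by
            ext e; simp only [mem_sdiff, mem_union, hW]; tauto
          unfold sgn; rw [hset]
      rw [hre, ← sum_mul, sum_powerset_neg_one_pow_sdiff]
      have hWe : W = ∅ ↔ q.1 ∪ q.2 = M := by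
        rw [hW, sdiff_eq_empty_iff_subset]
        exact ⟨fun h => Subset.antisymm (union_subset hq1 hq2) h, fun h => h ▸ Subset.rfl⟩
      by_cases hU : q.1 ∪ q.2 = M
      · rw [if_pos (hWe.2 hU), if_pos ⟨hd, hU⟩, one_mul]
      · rw [if_neg (fun h => hU (hWe.1 h)), if_neg (fun h => hU h.2), zero_mul]
    · rw [if_neg (fun h => hd h.1)]
      exact sum_eq_zero fun κ₁ _ => by rw [if_neg (fun h => hd h.2.2)]
  rw [sum_congr rfl hin, ← sum_filter]
  -- the complementary pairs are parametrised by `R ↦ (R, M ∖ R)`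
  symm
  refine sum_nbij' (fun R => (R, M \ R)) (fun q => q.1) ?_ ?_ ?_ ?_ ?_
  · intro R hR
    have hR' := mem_powerset.1 hR
    exact mem_filter.2 ⟨mem_product.2 ⟨hR, mem_powerset.2 sdiff_subset⟩, disjoint_sdiff, union_sdiff_of_subset hR'⟩
  · intro q hq; exact (mem_product.1 (mem_filter.1 hq).1).1
  · intro R _; rfl
  · intro q hq
    obtain ⟨-, hd, hU⟩ := mem_filter.1 hq
    refine Prod.ext rfl ?_
    show M \ q.1 = q.2
    rw [← hU, union_sdiff_left, Finset.sdiff_eq_self_iff_disjoint]; exact hd.symm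
  · intro R _; rfl

end IE

section Kernel

variable (D : Finset (Sym2 V)) (a b c : V)

/-- Twice the symmetric kernel of `Γ = q t − u_a u_b − u_a u_c − u_b u_c − u_a (n_a + n′_a)` on a pair of configurations, in the cell events of
`ThreePointGamma` (`Q`, `T = ab ∩ ac`, `Pa = bc ∖ ab`, `Pb = ac ∖ ab`, `Pc = ab ∖ ac`, `Tpa = T ∩ pivEv`, `Qsa = Q ∩ sepEv`). [this work] -/
def K2 (ξ ξ' : Finset (Sym2 V)) : ℝ :=
  pind (ξ ∈ Qe a b c ∧ ξ' ∈ conn a b ∩ conn a c) + pind (ξ ∈ conn a b ∩ conn a c ∧ ξ' ∈ Qe a b c)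
  - pind (ξ ∈ conn a b ∩ (conn a c)ᶜ ∧ ξ' ∈ conn a c ∩ (conn a b)ᶜ) - pind (ξ ∈ conn a c ∩ (conn a b)ᶜ ∧ ξ' ∈ conn a b ∩ (conn a c)ᶜ)
  - pind (ξ ∈ conn a b ∩ (conn a c)ᶜ ∧ ξ' ∈ conn b c ∩ (conn a b)ᶜ) - pind (ξ ∈ conn b c ∩ (conn a b)ᶜ ∧ ξ' ∈ conn a b ∩ (conn a c)ᶜ)
  - pind (ξ ∈ conn a c ∩ (conn a b)ᶜ ∧ ξ' ∈ conn b c ∩ (conn a b)ᶜ) - pind (ξ ∈ conn b c ∩ (conn a b)ᶜ ∧ ξ' ∈ conn a c ∩ (conn a b)ᶜ)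
  - pind (ξ ∈ conn b c ∩ (conn a b)ᶜ ∧ ξ' ∈ (conn a b ∩ conn a c) ∩ pivEv a b c)
  - pind (ξ ∈ (conn a b ∩ conn a c) ∩ pivEv a b c ∧ ξ' ∈ conn b c ∩ (conn a b)ᶜ)
  - pind (ξ ∈ conn b c ∩ (conn a b)ᶜ ∧ ξ' ∈ Qe a b c ∩ sepEv D a b c)
  - pind (ξ ∈ Qe a b c ∩ sepEv D a b c ∧ ξ' ∈ conn b c ∩ (conn a b)ᶜ)

/-- **`K2` is twice the kernel of `Γ`**: `2·Γ(D,p) = Σ_{ξ,ξ′ ⊆ D} w(ξ) w(ξ′) K2(ξ,ξ′)` (`Γ = GamP` of `…EdgePolarPrelim`, = `gamma_PrW`'s expression). [this work] -/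
theorem two_GamP_eq_sum_K2 (p : Sym2 V → ℝ) :
    2 * GamP D p a b c = ∑ ξ ∈ D.powerset, ∑ ξ' ∈ D.powerset, wtW D p ξ * wtW D p ξ' * K2 D a b c ξ ξ' := by
  have e : ∀ E E' : Set (Finset (Sym2 V)),
      ∑ ξ ∈ D.powerset, ∑ ξ' ∈ D.powerset, wtW D p ξ * wtW D p ξ' * pind (ξ ∈ E ∧ ξ' ∈ E') = PrW D p E * PrW D p E' := by
    intro E E'
    rw [PrW_eq_sum_ind, PrW_eq_sum_ind, sum_mul_sum]
    refine sum_congr rfl fun ξ _ => sum_congr rfl fun ξ' _ => ?_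
    rw [ind_eq_pind, ind_eq_pind]; unfold pind
    by_cases h1 : ξ ∈ E <;> by_cases h2 : ξ' ∈ E' <;> simp [h1, h2]
  unfold K2 Qe
  simp only [mul_add, mul_sub, sum_add_distrib, sum_sub_distrib, e]
  unfold GamP; ring

/-- Boolean form of the raw kernel. [this work] -/
def rawB (xab xac xbc xs xp yab yac ybc : Bool) : ℤ :=
  bI ((!xab && (!xac && !xbc)) && yac) + bI (((!xab && (!xac && !xbc)) && !xs) && (ybc && !yab))
  - bI ((xac && !xab) && (ybc && !yab)) - bI ((!xac && !xbc) && (ybc && !yab)) - bI ((!xac && !xbc) && (yac && !yab))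
  - bI (((xab && xac) && xp) && (ybc && !yab))

/-- Boolean form of `K2`. [this work] -/
def K2B (xab xac xbc xs xp yab yac ybc ys yp : Bool) : ℤ :=
  bI ((!xab && (!xac && !xbc)) && (yab && yac)) + bI ((xab && xac) && (!yab && (!yac && !ybc)))
  - bI ((xab && !xac) && (yac && !yab)) - bI ((xac && !xab) && (yab && !yac))
  - bI ((xab && !xac) && (ybc && !yab)) - bI ((xbc && !xab) && (yab && !yac))
  - bI ((xac && !xab) && (ybc && !yab)) - bI ((xbc && !xab) && (yac && !yab))
  - bI ((xbc && !xab) && ((yab && yac) && yp)) - bI (((xab && xac) && xp) && (ybc && !yab))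
  - bI ((xbc && !xab) && ((!yab && (!yac && !ybc)) && ys)) - bI (((!xab && (!xac && !xbc)) && xs) && (ybc && !yab))

set_option synthInstance.maxHeartbeats 200000 in
/-- **The raw kernel is half of `K2`** (Boolean check under transitivity of connection, `2¹⁰` cases). [this work] -/
theorem rawB_add_swap : ∀ xab xac xbc xs xp yab yac ybc ys yp : Bool,
    (xab = true → xac = true → xbc = true) → (xab = true → xbc = true → xac = true) → (xac = true → xbc = true → xab = true) →
    (yab = true → yac = true → ybc = true) → (yab = true → ybc = true → yac = true) → (yac = true → ybc = true → yab = true) →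
    rawB xab xac xbc xs xp yab yac ybc + rawB yab yac ybc ys yp xab xac xbc = K2B xab xac xbc xs xp yab yac ybc ys yp := by
  decide

variable {D a b c}

/-- **The raw kernel is half of `K2`**: `rawF(ξ,ξ′) + rawF(ξ′,ξ) = K2(ξ,ξ′)` for all configurations. [this work] -/
theorem rawF_add_rawF_swap (ξ ξ' : Finset (Sym2 V)) : rawF D a b c ξ ξ' + rawF D a b c ξ' ξ = K2 D a b c ξ ξ' := by
  have t1 : ∀ K : Finset (Sym2 V), K ∈ conn a b → K ∈ conn a c → K ∈ conn b c :=
    fun K hab hac => mem_conn.2 ((mem_conn.1 hab).symm.trans (mem_conn.1 hac))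
  have t2 : ∀ K : Finset (Sym2 V), K ∈ conn a b → K ∈ conn b c → K ∈ conn a c :=
    fun K hab hbc => mem_conn.2 ((mem_conn.1 hab).trans (mem_conn.1 hbc))
  have t3 : ∀ K : Finset (Sym2 V), K ∈ conn a c → K ∈ conn b c → K ∈ conn a b :=
    fun K hac hbc => mem_conn.2 ((mem_conn.1 hac).trans (mem_conn.1 hbc).symm)
  have key := rawB_add_swap (decide (ξ ∈ conn a b)) (decide (ξ ∈ conn a c)) (decide (ξ ∈ conn b c)) (decide (ξ ∈ sepEv D a b c))
    (decide (ξ ∈ pivEv a b c)) (decide (ξ' ∈ conn a b)) (decide (ξ' ∈ conn a c)) (decide (ξ' ∈ conn b c)) (decide (ξ' ∈ sepEv D a b c))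
    (decide (ξ' ∈ pivEv a b c))
    (by simpa only [decide_eq_true_eq] using t1 ξ) (by simpa only [decide_eq_true_eq] using t2 ξ) (by simpa only [decide_eq_true_eq] using t3 ξ)
    (by simpa only [decide_eq_true_eq] using t1 ξ') (by simpa only [decide_eq_true_eq] using t2 ξ') (by simpa only [decide_eq_true_eq] using t3 ξ')
  have key' : ((rawB (decide (ξ ∈ conn a b)) (decide (ξ ∈ conn a c)) (decide (ξ ∈ conn b c)) (decide (ξ ∈ sepEv D a b c))
      (decide (ξ ∈ pivEv a b c)) (decide (ξ' ∈ conn a b)) (decide (ξ' ∈ conn a c)) (decide (ξ' ∈ conn b c)) : ℤ) : ℝ)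
      + ((rawB (decide (ξ' ∈ conn a b)) (decide (ξ' ∈ conn a c)) (decide (ξ' ∈ conn b c)) (decide (ξ' ∈ sepEv D a b c))
      (decide (ξ' ∈ pivEv a b c)) (decide (ξ ∈ conn a b)) (decide (ξ ∈ conn a c)) (decide (ξ ∈ conn b c)) : ℤ) : ℝ)
      = ((K2B (decide (ξ ∈ conn a b)) (decide (ξ ∈ conn a c)) (decide (ξ ∈ conn b c)) (decide (ξ ∈ sepEv D a b c))
      (decide (ξ ∈ pivEv a b c)) (decide (ξ' ∈ conn a b)) (decide (ξ' ∈ conn a c)) (decide (ξ' ∈ conn b c)) (decide (ξ' ∈ sepEv D a b c))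
      (decide (ξ' ∈ pivEv a b c)) : ℤ) : ℝ) := by exact_mod_cast key
  unfold rawB K2B at key'
  push_cast at key'
  unfold rawF gqG gqH K2 Qe
  simp only [Set.mem_inter_iff, Set.mem_compl_iff, pind_eq_bI, Bool.decide_and, decide_not] at key' ⊢
  linarith

end Kernel

section Main

variable {D : Finset (Sym2 V)} {a b c : V} {O M : Finset (Sym2 V)}

/-- The interval split of `K2` is TWICE the complete-monotonicity sum at the diagonal base. [this work] -/
theorem interval_sum_eq_two_combSum (hO : O ⊆ D) (hM : M ⊆ D) (hOM : Disjoint O M) :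
    ∑ R ∈ M.powerset, K2 D a b c (O ∪ R) (O ∪ (M \ R)) = 2 * ∑ κ ∈ Asg M, sgn M κ * (- gcert D a b c (trip O O O κ)) := by
  have hc : ∑ κ ∈ Asg M, sgn M κ * (- gcert D a b c (trip O O O κ)) = ∑ R ∈ M.powerset, rawF D a b c (O ∪ R) (O ∪ (M \ R)) := by
    rw [combSum_eq_raw hO hM hOM, sum_Asg_ignore_fst (fun R S => rawF D a b c (O ∪ R) (O ∪ S))]
  have hswap : ∑ R ∈ M.powerset, rawF D a b c (O ∪ (M \ R)) (O ∪ R) = ∑ R ∈ M.powerset, rawF D a b c (O ∪ R) (O ∪ (M \ R)) := by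
    refine sum_nbij' (fun R => M \ R) (fun R => M \ R) ?_ ?_ ?_ ?_ ?_
    · intro R _; exact mem_powerset.2 sdiff_subset
    · intro R _; exact mem_powerset.2 sdiff_subset
    · intro R hR; exact Finset.sdiff_sdiff_eq_self (mem_powerset.1 hR)
    · intro R hR; exact Finset.sdiff_sdiff_eq_self (mem_powerset.1 hR)
    · intro R hR; rw [Finset.sdiff_sdiff_eq_self (mem_powerset.1 hR)]
  calc ∑ R ∈ M.powerset, K2 D a b c (O ∪ R) (O ∪ (M \ R))
      = ∑ R ∈ M.powerset, (rawF D a b c (O ∪ R) (O ∪ (M \ R)) + rawF D a b c (O ∪ (M \ R)) (O ∪ R)) :=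
        sum_congr rfl fun R _ => (rawF_add_rawF_swap _ _).symm
    _ = ∑ R ∈ M.powerset, rawF D a b c (O ∪ R) (O ∪ (M \ R)) + ∑ R ∈ M.powerset, rawF D a b c (O ∪ (M \ R)) (O ∪ R) := sum_add_distrib
    _ = 2 * ∑ κ ∈ Asg M, sgn M κ * (- gcert D a b c (trip O O O κ)) := by rw [hswap, hc]; ring

/-- **THEOREM (Γ is comb-positive; weight-free interval splits, prim-ineq-gen-2's C2)**: for every support `D` and all disjoint `O, M ⊆ D`,
`Σ_{R ⊆ M} K2(O ∪ R, O ∪ (M ∖ R)) ≥ 0` — every tensor-Bernstein coefficient of `Γ` is nonnegative (GAMMA-COMB-THEOREM.md; ttrl2 census line 489,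
0 / 1.7·10⁸ intervals for `n ≤ 6`). [this work] -/
theorem gammaKernel_interval_nonneg (hO : O ⊆ D) (hM : M ⊆ D) (hOM : Disjoint O M) :
    0 ≤ ∑ R ∈ M.powerset, K2 D a b c (O ∪ R) (O ∪ (M \ R)) := by
  have hMO : ∀ e ∈ M, e ∉ O := fun e he heO => disjoint_left.1 hOM heO he
  rw [interval_sum_eq_two_combSum hO hM hOM]
  exact mul_nonneg (by norm_num) (gcert_complete_monotone hO hM hMO hMO hMO)

end Main

section Bernstein

variable (D : Finset (Sym2 V)) (p : Sym2 V → ℝ) (a b c : V)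

omit [Fintype V] in
/-- The tensor-Bernstein weight of the pattern (`O` open in both copies, `M` mixed, the rest closed in both). [this work] -/
def bw (O M : Finset (Sym2 V)) : ℝ :=
  ∏ e ∈ D, (if e ∈ O then p e * p e else if e ∈ M then p e * (1 - p e) else (1 - p e) * (1 - p e))

/-- The interval split (tensor-Bernstein coefficient) of `2Γ` at the pattern `(O, M)`. [this work] -/
def S2 (O M : Finset (Sym2 V)) : ℝ := ∑ R ∈ M.powerset, K2 D a b c (O ∪ R) (O ∪ (M \ R))

variable {D p a b c}

omit [Fintype V] in
/-- The product of the weights of a complementary pair is the Bernstein weight of its pattern. [this work] -/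
theorem wtW_mul_wtW_eq_bw {O M R : Finset (Sym2 V)} (hR : R ⊆ M) (hOM : Disjoint O M) :
    wtW D p (O ∪ R) * wtW D p (O ∪ (M \ R)) = bw D p O M := by
  unfold wtW bw
  rw [← prod_mul_distrib]
  refine prod_congr rfl fun e _ => ?_
  by_cases hO : e ∈ O
  · have hM : e ∉ M := fun h => disjoint_left.1 hOM hO h
    simp [hO, hM]
  · by_cases hM : e ∈ M
    · by_cases hRe : e ∈ R
      · simp [hO, hM, hRe]
      · simp [hO, hM, hRe]; ring
    · have hRe : e ∉ R := fun h => hM (hR h)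
      simp [hO, hM, hRe]

omit [Fintype V] in
/-- **Regrouping pairs of configurations by pattern**: `Σ_{ξ,ξ′} w(ξ)w(ξ′) f(ξ,ξ′) = Σ_{O} Σ_{M ⊆ D∖O} bw(O,M) Σ_{R ⊆ M} f(O ∪ R, O ∪ (M∖R))`. [this work] -/
theorem sum_pairs_eq_sum_patterns (f : Finset (Sym2 V) → Finset (Sym2 V) → ℝ) :
    ∑ ξ ∈ D.powerset, ∑ ξ' ∈ D.powerset, wtW D p ξ * wtW D p ξ' * f ξ ξ' =
      ∑ O ∈ D.powerset, ∑ M ∈ (D \ O).powerset, bw D p O M * ∑ R ∈ M.powerset, f (O ∪ R) (O ∪ (M \ R)) := by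
  -- flatten both sides
  set r : Finset (Finset (Sym2 V) × (Finset (Sym2 V) × Finset (Sym2 V))) :=
    (D.powerset ×ˢ (D.powerset ×ˢ D.powerset)).filter (fun t => t.2.1 ⊆ D \ t.1 ∧ t.2.2 ⊆ t.2.1) with hr
  have hmem : ∀ t : Finset (Sym2 V) × (Finset (Sym2 V) × Finset (Sym2 V)),
      t ∈ r ↔ t.1 ⊆ D ∧ t.2.1 ⊆ D \ t.1 ∧ t.2.2 ⊆ t.2.1 := by
    intro t
    simp only [hr, mem_filter, mem_product, mem_powerset]
    constructor
    · rintro ⟨⟨h1, -, -⟩, h2, h3⟩; exact ⟨h1, h2, h3⟩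
    · rintro ⟨h1, h2, h3⟩; exact ⟨⟨h1, h2.trans sdiff_subset, h3.trans (h2.trans sdiff_subset)⟩, h2, h3⟩
  set g : Finset (Sym2 V) → Finset (Sym2 V) × Finset (Sym2 V) → ℝ := fun O q => bw D p O q.1 * f (O ∪ q.2) (O ∪ (q.1 \ q.2)) with hg
  have step1 := sum_finset_product' r D.powerset (fun O => ((D \ O).powerset ×ˢ D.powerset).filter (fun q => q.2 ⊆ q.1))
      (fun t => by
        rw [hmem, mem_filter, mem_product, mem_powerset, mem_powerset, mem_powerset]
        constructor
        · rintro ⟨h1, h2, h3⟩; exact ⟨h1, ⟨h2, h3.trans (h2.trans sdiff_subset)⟩, h3⟩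
        · rintro ⟨h1, ⟨h2, -⟩, h3⟩; exact ⟨h1, h2, h3⟩) (f := g)
  have step2 : ∀ O : Finset (Sym2 V), ∑ q ∈ ((D \ O).powerset ×ˢ D.powerset).filter (fun q => q.2 ⊆ q.1), g O q =
      ∑ M ∈ (D \ O).powerset, ∑ R ∈ M.powerset, g O (M, R) := fun O =>
    sum_finset_product' (((D \ O).powerset ×ˢ D.powerset).filter (fun q => q.2 ⊆ q.1)) (D \ O).powerset (fun M => M.powerset)
      (fun q => by
        rw [mem_filter, mem_product, mem_powerset, mem_powerset, mem_powerset]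
        constructor
        · rintro ⟨⟨h1, -⟩, h2⟩; exact ⟨h1, h2⟩
        · rintro ⟨h1, h2⟩; exact ⟨⟨h1, h2.trans (h1.trans sdiff_subset)⟩, h2⟩) (f := fun M R => g O (M, R))
  have hR : ∑ O ∈ D.powerset, ∑ M ∈ (D \ O).powerset, bw D p O M * ∑ R ∈ M.powerset, f (O ∪ R) (O ∪ (M \ R)) =
      ∑ t ∈ r, g t.1 t.2 := by
    rw [step1]
    refine sum_congr rfl fun O _ => ?_
    rw [step2 O]
    refine sum_congr rfl fun M _ => ?_
    rw [mul_sum]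
  rw [hR, ← sum_product']
  -- bijection `(O,M,R) ↦ (O ∪ R, O ∪ (M ∖ R))`
  symm
  refine sum_nbij' (fun t => (t.1 ∪ t.2.2, t.1 ∪ (t.2.1 \ t.2.2))) (fun q => (q.1 ∩ q.2, ((q.1 ∪ q.2) \ (q.1 ∩ q.2), q.1 \ q.2))) ?_ ?_ ?_ ?_ ?_
  · intro t ht
    obtain ⟨h1, h2, h3⟩ := (hmem t).1 ht
    have hM : t.2.1 ⊆ D := h2.trans sdiff_subset
    exact mem_product.2 ⟨mem_powerset.2 (union_subset h1 (h3.trans hM)), mem_powerset.2 (union_subset h1 (sdiff_subset.trans hM))⟩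
  · intro q hq
    obtain ⟨h1, h2⟩ := mem_product.1 hq
    rw [mem_powerset] at h1 h2
    refine (hmem _).2 ⟨inter_subset_left.trans h1, ?_, ?_⟩
    · intro e he
      simp only [mem_sdiff, mem_union, mem_inter] at he ⊢
      exact ⟨he.1.elim (fun h => h1 h) (fun h => h2 h), he.2⟩
    · intro e he
      simp only [mem_sdiff, mem_union, mem_inter] at he ⊢
      exact ⟨Or.inl he.1, fun h => he.2 h.2⟩
  · intro t ht
    obtain ⟨-, h2, h3⟩ := (hmem t).1 ht
    have hOM : Disjoint t.1 t.2.1 := disjoint_left.2 fun e he hm => (mem_sdiff.1 (h2 hm)).2 he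
    obtain ⟨O, M, R⟩ := t
    simp only at h2 h3 hOM ⊢
    have d1 : ∀ e, e ∈ R → e ∉ O := fun e he hO => disjoint_left.1 hOM hO (h3 he)
    have d2 : ∀ e, e ∈ M → e ∉ O := fun e he hO => disjoint_left.1 hOM hO he
    refine Prod.ext ?_ (Prod.ext ?_ ?_) <;> simp only <;> ext e <;>
      simp only [mem_inter, mem_union, mem_sdiff] <;>
      constructor <;> intro h
    · rcases h.1 with h' | h'
      · exact h'
      · rcases h.2 with h'' | h''
        · exact h''
        · exact absurd h' h''.2
    · exact ⟨Or.inl h, Or.inl h⟩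
    · obtain ⟨h', hn⟩ := h
      rcases h' with (h' | h') | (h' | h')
      · exact absurd ⟨Or.inl h', Or.inl h'⟩ hn
      · exact h3 h'
      · exact absurd ⟨Or.inl h', Or.inl h'⟩ hn
      · exact h'.1
    · refine ⟨?_, fun hh => d2 e h ?_⟩
      · by_cases hRe : e ∈ R
        · exact Or.inl (Or.inr hRe)
        · exact Or.inr (Or.inr ⟨h, hRe⟩)
      · rcases hh.1 with ho | hr'
        · exact ho
        · exact absurd (hh.2.resolve_left (d1 e hr')) (fun hh' => hh'.2 hr')
    · obtain ⟨h', hn⟩ := h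
      rcases h' with h' | h'
      · exact absurd (Or.inl h') hn
      · exact h'
    · exact ⟨Or.inr h, fun hh => hh.elim (d1 e h) (fun hh' => hh'.2 h)⟩
  · intro q _
    obtain ⟨ξ, ξ'⟩ := q
    refine Prod.ext ?_ ?_ <;> simp only <;> ext e <;> simp only [mem_inter, mem_union, mem_sdiff] <;> tauto
  · intro t ht
    obtain ⟨-, h2, h3⟩ := (hmem t).1 ht
    have hOM : Disjoint t.1 t.2.1 := disjoint_left.2 fun e he hm => (mem_sdiff.1 (h2 hm)).2 he
    simp only [hg]
    rw [← wtW_mul_wtW_eq_bw h3 hOM]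

/-- **Γ IS A NONNEGATIVE COMBINATION OF TENSOR-BERNSTEIN MONOMIALS** (comb positivity, explicit form):
`2·Γ(D,p) = Σ_{O ⊆ D} Σ_{M ⊆ D∖O} bw(O,M;p) · S2(O,M)` with every coefficient `S2(O,M) ≥ 0`. [this work] -/
theorem gamP_bernstein_expansion :
    2 * GamP D p a b c = ∑ O ∈ D.powerset, ∑ M ∈ (D \ O).powerset, bw D p O M * S2 D a b c O M ∧
      ∀ O M : Finset (Sym2 V), O ⊆ D → M ⊆ D \ O → 0 ≤ S2 D a b c O M := by
  refine ⟨?_, fun O M hO hM => ?_⟩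
  · rw [two_GamP_eq_sum_K2]; exact sum_pairs_eq_sum_patterns (fun ξ ξ' => K2 D a b c ξ ξ')
  · exact gammaKernel_interval_nonneg hO (hM.trans sdiff_subset) (disjoint_left.2 fun e he hm => (mem_sdiff.1 (hM hm)).2 he)

end Bernstein

end ThreePointGamma

end Summit.CriticalPhenomena.PercolationContinuityZ3.Theorems

end
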